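import Summits.PneNP.PneNP.Theses.Descriptive
import Summits.PneNP.PneNP.Theorems.DescriptiveFaginBridge
import Summits.PneNP.PneNP.Theorems.DescriptiveThesisGivesNoPOptimalTaut
import Literature.Computability.MetaComplexity.OptimalProofSystemOfCoNE
import Literature.Computability.MetaComplexity.ProofSystemsProofs
import Literature.Computability.Complexity.NegCNFTranscoder
import Literature.Computability.Complexity.Reductions
import Literature.Barriers.QuantumAdvantage.AaronsonChenOracle

/-!
# Decomposition audit for the deciding crux `NoPOptimalTaut` (stmt-PneNP-8869, route PneNP/Descriptive)

Companion to `Cruxes/NoPOptimalTaut/STRATEGY-CENSUS.md` (crux-strategist `cstrat-stmt-PneNP-8869-r1`,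
RESTATED deciding-crux re-audit under the BC2 REDIRECT exemption, 2026-08-17). Everything here is
`sorry`-free and imports only LANDED modules; nothing here is a line skeleton (no `stub_*`).

`X := NoPOptimalTaut` = "`TAUT` has no p-optimal Cook–Reckhow proof system" (Krajíček–Pudlák 1989;
Pudlák 2017, Conjecture 11 `CON`). What is CHECKED here (section = row of the census table):

* §0 Read-back: `X → PneNP` (`X_ge_S`, the route's `closes`), `X → E ≠ NE` (Krajíček 2019 Cor. 21.1.3,
  tree), `E = NE → ¬X`, `¬PneNP → ¬X`; under `¬PneNP` the poly-time DECIDER is a p-optimal AND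
  polynomially bounded proof system for every `L ∈ P` (`decider_pOptimal_of_mem_P`, generic in `L`).
* §1 The shape of every binary split (kernel meta-lemmas): `split_piece_ge_S` — if `X ⇐ P₁ ∧ P₂` and
  `¬S ⊢ P₁` then `P₂ ⊢ S`; `dichotomy_other_iff_X` — in a case split `(R → X) ∧ (¬R → X)` a PROVED
  consequence `¬X → R` makes the other piece EQUIVALENT to `X`; `bridge_iff` — a chain bridge
  `M → X` over a consequence `M` is `X ∨ ¬M` (its `E`-part is `¬M`).
* §2 D1, the `NP = coNP` case split in proof-system clothing: `PieceA` (no NON-polynomially-bounded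
  system is p-optimal) / `PieceB` (no polynomially bounded system is p-optimal); assembly PROVED
  (`D1_assembly`); `pieceA_iff`, `pieceB_iff` (they are `¬HasPB → X` and `HasPB → X`);
  `pieceA_of_not_pneNP` (A is implied by `¬S`: useless toward `S`) and `pieceB_ge_S : PieceB → PneNP`.
* §3 D3, chain splits at consequences: `M = (E ≠ NE)` (`D3a_M_ge_S : E ≠ NE → PneNP`, bridge implied by
  `¬S`); `M = CON ∨ SAT` (Pudlák) with `NoPOptimalSat` typed (`D3c_M_ge_S`); `M = PneNP` itself.
* §4 D4, bridges from strengthenings: `NoOptimalTaut → X` is ONE LINE (`D4a_bridge`, RULE-N);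
  `DescriptiveThesis → X` is the proved item and `DescriptiveThesis → PneNP` is LANDED (`D4b_T_ge_S_landed`);
  the UP conjecture and its KMT 2003 bridge are typed (`NoCompleteUP`, `KMT2003Bridge`, in print only).
* §5 D5, instance splits at a fixed system `V₀`: `Inst V₀` ("`V₀` is not p-optimal"), `Univ V₀` ("if any
  system is p-optimal then `V₀` is"); assembly = modus ponens; `inst_of_X`, `univ_iff` (the bridge is
  `X ∨ ¬Inst V₀`: costume in the believed world), `univ_iff_X_of_inst`.
* §6 D2/D8, generic case split and Krajíček's trichotomy seam (`krajicek_seam`).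
* §7 D6, the language ladder typed (`NoPOptimalFor`, `X_TQBF := NoPOptimalFor TQBF`).

References: [KrajicekPudlak1989] JSL 54; [Krajicek2019] *Proof Complexity* CUP, Problem 1.5.5, Cor. 21.1.3,
Lemma 21.1.4, Thm. 21.4.3; [ChenFlum2010] ICALP, Thm. 2/6/13/15/16; [ChenFlum2010b] CSL, Thm. 5/6/8, Prop. 3/9;
[KoblerMessnerToran2003] Inf. Comput. 184; [BeyersdorffSadowski2011] MLQ 57, Thm. 4.1/6.5; [Pudlak2017]
BSL 23, §6.1 (Conj. 11–15, figure); [Dose2020] arXiv:1909.02839; [CookKrajicek2007] JSL 72.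
-/

set_option linter.dupNamespace false
set_option linter.unusedVariables false

namespace Summit.PneNP.PneNP.Cruxes.NoPOptimalTaut.DecompositionAudit

open Literature.Computability.Complexity Literature.Computability.Complexity.Nondeterministic
open Literature.Computability.MetaComplexity
open Literature.ModelTheory.FiniteModelTheory
open Summit.PneNP.PneNP.Theses.Descriptive (NoPOptimalTaut DescriptiveThesis ThesisGivesNoPOptimalTaut
  FaginBridge closes)

/-! ## Vocabulary (spelled out over the tree's `IsProofSystemFor` / `PSimulates` / `Simulates`) -/

/-- `V` is a p-optimal proof system for the language `L`. [cite: KrajicekPudlak1989, §1] -/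
def IsPOptimalFor (L : Language Bool) (V : List Bool → List Bool → Bool) : Prop :=
  IsProofSystemFor V L ∧ ∀ W : List Bool → List Bool → Bool, IsProofSystemFor W L → PSimulates V W

/-- "`L` has no p-optimal proof system" (the crux is the case `L = TAUT`). [cite: KoblerMessnerToran2003, §1] -/
def NoPOptimalFor (L : Language Bool) : Prop :=
  ¬ ∃ V : List Bool → List Bool → Bool, IsPOptimalFor L V

/-- The crux, read back: `NoPOptimalTaut` is literally `NoPOptimalFor TAUT`. -/
theorem X_iff : NoPOptimalTaut ↔ NoPOptimalFor TAUT := Iff.rfl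

/-- "`TAUT` has no OPTIMAL proof system" (Pudlák's `CON^N`; Krajíček–Pudlák). [cite: Krajicek2019, Problem 1.5.5] -/
def NoOptimalTaut : Prop :=
  ¬ ∃ V : List Bool → List Bool → Bool, IsProofSystemFor V TAUT ∧
    ∀ W : List Bool → List Bool → Bool, IsProofSystemFor W TAUT → Simulates V W

/-- "`SAT` has no p-optimal proof system" (Pudlák 2017, Conjecture `SAT`). [cite: Pudlak2017, §6.3] -/
def NoPOptimalSat : Prop := NoPOptimalFor SAT

/-! ## §0 Read-back: where the crux stands -/

/-- The crux is AT OR ABOVE the summit: the route's deciding theorem. -/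
theorem X_ge_S : NoPOptimalTaut → PneNP := closes

/-- The crux implies `E ≠ NE` (Krajíček 2019, Cor. 21.1.3; tree facts, proved). [cite: Krajicek2019, Cor. 21.1.3] -/
theorem X_imp_E_ne_NE : NoPOptimalTaut → E ≠ NE :=
  E_ne_NE_of_no_pOptimalTaut KrajicekPudlak1989_pOptimalTaut_of_E_eq_NE_holds

/-- Negation side: `E = NE` refutes the crux (Krajíček–Pudlák 1989, tree, proved). [cite: KrajicekPudlak1989, §1] -/
theorem not_X_of_E_eq_NE (hE : E = NE) : ¬ NoPOptimalTaut := fun hX =>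
  hX (KrajicekPudlak1989_pOptimalTaut_of_E_eq_NE_holds hE)

/-- `¬S` refutes the crux (contrapositive of `closes`). -/
theorem not_X_of_not_pneNP (hS : ¬ PneNP) : ¬ NoPOptimalTaut := fun hX => hS (closes hX)

/-- Under `¬PneNP` the prelude classes coincide. [cite: CookClay2006, §1] -/
theorem P_eq_NP_of_not_pneNP (hS : ¬ PneNP) : Classes.P = Nondeterministic.NP := by
  by_contra hne
  exact hS (pneNP_shape_of_P_ne_NP hne)

/-- Under `¬PneNP`, `TAUT ∈ P`. -/
theorem TAUT_mem_P_of_not_pneNP (hS : ¬ PneNP) : TAUT ∈ Classes.P := by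
  have hco : (TAUT)ᶜ ∈ Nondeterministic.NP := TAUT_mem_coNP_holds
  rw [← P_eq_NP_of_not_pneNP hS] at hco
  exact compl_mem_P_iff.1 hco

/-- Under `¬PneNP`, `SAT ∈ P`. -/
theorem SAT_mem_P_of_not_pneNP (hS : ¬ PneNP) : SAT ∈ Classes.P := by
  have h : SAT ∈ Nondeterministic.NP := SAT_mem_NP_holds
  rw [← P_eq_NP_of_not_pneNP hS] at h
  exact h

/-- Under `¬PneNP`, `E = NE` (every `NP` set, in particular every sparse one, is in `P`;
Hartmanis–Immerman–Sewelson 1985 Thm. 1, tree). [cite: HartmanisImmermanSewelson1985, Thm. 1] -/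
theorem E_eq_NE_of_not_pneNP (hS : ¬ PneNP) : E = NE :=
  UpSep.E_eq_NE_of_sparse_NP_subset_P fun S _ hSNP => by
    rw [P_eq_NP_of_not_pneNP hS]; exact hSNP

/-- **The decider system.** For every `L ∈ P` the verifier `V x π := [x ∈ L]` (ignoring the proof) is a
Cook–Reckhow proof system for `L` that p-simulates EVERY proof system for `L` (identity translation) and is
polynomially bounded (the empty proof works). This is the construction inside the route's `closes`, made
generic in `L` and with the polynomial bound recorded. [cite: KrajicekPudlak1989, §1] [cite: ChenFlum2010b, §3 (2)] -/
theorem decider_pOptimal_of_mem_P {L : Language Bool} (hLP : L ∈ Classes.P) :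
    ∃ V : List Bool → List Bool → Bool, IsPOptimalFor L V ∧ IsPolyBounded V := by
  have hA : ((fun z : List Bool => (boolUnpair z).1) ⁻¹' L : Language Bool) ∈ Classes.P :=
    Literature.Computability.Complexity.preimage_mem_P hLP boolUnpairFst_mem_FP
  obtain ⟨p, M, hM⟩ := indicatorFn_mem_FP hA
  have hV : ∀ x π : List Bool,
      (((fun z : List Bool => (boolUnpair z).1) ⁻¹' L : Set (List Bool))).boolIndicator
        (boolPair x π) = true ↔ x ∈ L := by
    intro x π
    rw [← Set.mem_iff_boolIndicator]
    simp only [Set.mem_preimage, boolUnpair_boolPair]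
    exact Iff.rfl
  refine ⟨fun x π =>
      (((fun z : List Bool => (boolUnpair z).1) ⁻¹' L : Set (List Bool))).boolIndicator (boolPair x π),
    ⟨⟨⟨p, M, fun a => hM (boolPair a.1 a.2)⟩, fun x => ?_⟩, fun W hW => ?_⟩, ?_⟩
  · exact ⟨fun hx => ⟨[], (hV x []).2 hx⟩, fun ⟨π, hπ⟩ => (hV x π).1 hπ⟩
  · exact ⟨fun _ π => π, polyTimeComputable_snd_holds, fun x π hπ => (hV x π).2 (hW.mem_of_eq_true hπ)⟩
  · exact ⟨0, fun x π hπ => ⟨[], by simp, (hV x []).2 ((hV x π).1 hπ)⟩⟩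

/-- Under `¬PneNP` every `L ∈ P` has a p-optimal, polynomially bounded proof system; in particular the
crux and its `SAT` twin are both false (`CON ∨ SAT` fails under `P = NP`). -/
theorem not_noPOptimalFor_of_mem_P {L : Language Bool} (hLP : L ∈ Classes.P) : ¬ NoPOptimalFor L := by
  obtain ⟨V, hV, -⟩ := decider_pOptimal_of_mem_P hLP
  exact fun h => h ⟨V, hV⟩

/-! ## §1 The shape of every binary split (meta-lemmas used in every row below) -/

/-- **Dichotomy of binary splits.** If `X ⇐ P₁ ∧ P₂` (any assembly) and the piece `P₁` is implied by `¬S`,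
then the other piece `P₂` already implies the summit `S`. So in every binary split of an at-least-summit
crux, a piece that is "useless under `¬S`" forces its partner to be summit-or-harder. -/
theorem split_piece_ge_S {P₁ P₂ : Prop} (hasm : P₁ → P₂ → NoPOptimalTaut) (h₁ : ¬ PneNP → P₁) :
    P₂ → PneNP := fun h₂ =>
  Classical.byContradiction fun hS => hS (closes (hasm (h₁ hS) h₂))

/-- Case-split assembly `(R → X) ∧ (¬R → X) ⊢ X` (excluded middle: the seam is always trivial). -/
theorem dichotomy_assembly (R : Prop) (h₁ : R → NoPOptimalTaut) (h₂ : ¬ R → NoPOptimalTaut) :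
    NoPOptimalTaut := (Classical.em R).elim h₁ h₂

/-- In a case split the two pieces are "consequences of p-optimality": `(R → X) ↔ (¬X → ¬R)` and
`(¬R → X) ↔ (¬X → R)`. -/
theorem dichotomy_pieces_are_consequences (R : Prop) :
    ((R → NoPOptimalTaut) ↔ (¬ NoPOptimalTaut → ¬ R)) ∧
      ((¬ R → NoPOptimalTaut) ↔ (¬ NoPOptimalTaut → R)) := by
  constructor <;> constructor
  · exact fun h hX hR => hX (h hR)
  · exact fun h hR => Classical.byContradiction fun hX => h hX hR
  · exact fun h hX => Classical.byContradiction fun hR => hX (h hR)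
  · exact fun h hR => Classical.byContradiction fun hX => hR (h hX)

/-- **RULE-N for case splits.** If the consequence `¬X → R` is already PROVED (the KMT 2003 / Chen–Flum /
Beyersdorff–Sadowski lists), then the piece `¬R → X` holds outright and the other piece `R → X` is
EQUIVALENT to the crux — a single open piece, i.e. a restatement. -/
theorem dichotomy_other_iff_X {R : Prop} (hknown : ¬ NoPOptimalTaut → R) :
    (¬ R → NoPOptimalTaut) ∧ ((R → NoPOptimalTaut) ↔ NoPOptimalTaut) :=
  ⟨fun hR => Classical.byContradiction fun hX => hR (hknown hX),
    fun h => Classical.byContradiction fun hX => hX (h (hknown hX)), fun hX _ => hX⟩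

/-- If `¬S` decides `R` negatively then the piece `¬R → X` is summit-or-harder and the piece `R → X` is
implied by `¬S`. (With `R := E ≠ NE`, `R := ¬HasPolyBoundedProofSystem TAUT`, … below.) -/
theorem dichotomy_decided_by_not_S {R : Prop} (hdec : ¬ PneNP → ¬ R) :
    ((¬ R → NoPOptimalTaut) → PneNP) ∧ (¬ PneNP → (R → NoPOptimalTaut)) :=
  ⟨split_piece_ge_S (P₁ := R → NoPOptimalTaut) (fun h₁ h₂ => dichotomy_assembly R h₁ h₂)
      (fun hS hR => absurd hR (hdec hS)),
    fun hS hR => absurd hR (hdec hS)⟩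

/-- **Chain splits.** For a consequence `M` of the crux, the bridge piece `M → X` is exactly `X ∨ ¬M`:
its "`E`-part" is `¬M`. When `M` is believed TRUE the bridge is the crux again in the believed world, so a
chain split is honest only if the bridge carries a MECHANISM (Ribet for Frey–Serre) — none is in print for
any consequence `M` of `CON` (Pudlák 2017 §6, figure). -/
theorem bridge_iff (M : Prop) : (M → NoPOptimalTaut) ↔ (NoPOptimalTaut ∨ ¬ M) :=
  ⟨fun h => (Classical.em M).elim (fun hM => Or.inl (h hM)) Or.inr,
    fun h hM => h.elim id fun hnM => absurd hM hnM⟩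

/-- Chain assembly `M ∧ (M → X) ⊢ X` (modus ponens). -/
theorem chain_assembly {M : Prop} (hM : M) (hbridge : M → NoPOptimalTaut) : NoPOptimalTaut := hbridge hM

/-- In a chain split at a consequence `M` that is refuted by `¬S`, `M` is summit-or-harder and the bridge is
implied by `¬S`. -/
theorem chain_decided_by_not_S {M : Prop} (hdec : ¬ PneNP → ¬ M) :
    (M → PneNP) ∧ (¬ PneNP → (M → NoPOptimalTaut)) :=
  ⟨split_piece_ge_S (P₁ := M → NoPOptimalTaut) (fun hb hM => hb hM) (fun hS hM => absurd hM (hdec hS)),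
    fun hS hM => absurd hM (hdec hS)⟩

/-! ## §2 D1 — the `NP = coNP` case split in proof-system clothing -/

/-- Piece A: no proof system for `TAUT` that is NOT polynomially bounded is p-optimal
(≡ `NP ≠ coNP → X`, see `pieceA_iff`). -/
def PieceA : Prop :=
  ∀ V : List Bool → List Bool → Bool, IsProofSystemFor V TAUT → ¬ IsPolyBounded V →
    ∃ W : List Bool → List Bool → Bool, IsProofSystemFor W TAUT ∧ ¬ PSimulates V W

/-- Piece B: no polynomially bounded proof system for `TAUT` is p-optimal (≡ `NP = coNP → X`, see
`pieceB_iff`). -/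
def PieceB : Prop :=
  ∀ V : List Bool → List Bool → Bool, IsProofSystemFor V TAUT → IsPolyBounded V →
    ∃ W : List Bool → List Bool → Bool, IsProofSystemFor W TAUT ∧ ¬ PSimulates V W

/-- (b) The assembly `PieceA ∧ PieceB ⊢ X` — PROVED (case analysis on polynomial boundedness). -/
theorem D1_assembly (hA : PieceA) (hB : PieceB) : NoPOptimalTaut := by
  rintro ⟨V, hV, hopt⟩
  by_cases hpb : IsPolyBounded V
  · obtain ⟨W, hW, hnot⟩ := hB V hV hpb
    exact hnot (hopt W hW)
  · obtain ⟨W, hW, hnot⟩ := hA V hV hpb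
    exact hnot (hopt W hW)

/-- `PieceB ↔ (HasPolyBoundedProofSystem TAUT → X)`: by Cook–Reckhow (`hasPolyBoundedProofSystem_iff_mem_NP`)
the antecedent is `TAUT ∈ NP`, i.e. `NP = coNP`. A p-optimal system p-simulates, hence simulates, a polynomially
bounded one and is then itself polynomially bounded (`IsPolyBounded.of_pSimulates`, tree). -/
theorem pieceB_iff : PieceB ↔ (HasPolyBoundedProofSystem TAUT → NoPOptimalTaut) := by
  constructor
  · rintro hB ⟨W₀, hW₀, hpb₀⟩ ⟨V, hV, hopt⟩
    have hVpb : IsPolyBounded V := IsPolyBounded.of_pSimulates_holds (hopt W₀ hW₀) hpb₀ hV hW₀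
    obtain ⟨W, hW, hnot⟩ := hB V hV hVpb
    exact hnot (hopt W hW)
  · intro h V hV hpb
    by_contra hall
    push Not at hall
    exact h ⟨V, hV, hpb⟩ ⟨V, hV, fun W hW => hall W hW⟩

/-- `PieceA ↔ (¬HasPolyBoundedProofSystem TAUT → X)` (the `NP ≠ coNP` branch). -/
theorem pieceA_iff : PieceA ↔ (¬ HasPolyBoundedProofSystem TAUT → NoPOptimalTaut) := by
  constructor
  · rintro hA hno ⟨V, hV, hopt⟩
    have hnpb : ¬ IsPolyBounded V := fun hpb => hno ⟨V, hV, hpb⟩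
    obtain ⟨W, hW, hnot⟩ := hA V hV hnpb
    exact hnot (hopt W hW)
  · intro h V hV hnpb
    by_contra hall
    push Not at hall
    have hno : ¬ HasPolyBoundedProofSystem TAUT := fun ⟨W₀, hW₀, hpb₀⟩ =>
      hnpb (IsPolyBounded.of_pSimulates_holds (hall W₀ hW₀) hpb₀ hV hW₀)
    exact h hno ⟨V, hV, fun W hW => hall W hW⟩

/-- The two branches of D1 are complementary by excluded middle only: together with `pieceA_iff`/`pieceB_iff`,
`X ↔ PieceA ∧ PieceB`. -/
theorem X_iff_pieceA_and_pieceB : NoPOptimalTaut ↔ PieceA ∧ PieceB :=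
  ⟨fun hX => ⟨pieceA_iff.2 fun _ => hX, pieceB_iff.2 fun _ => hX⟩, fun h => D1_assembly h.1 h.2⟩

/-- The `HasPolyBoundedProofSystem TAUT` switch is `TAUT ∈ NP` (Cook–Reckhow 1979 Prop. 1.4, tree). -/
theorem hasPB_TAUT_iff : HasPolyBoundedProofSystem TAUT ↔ TAUT ∈ Nondeterministic.NP :=
  hasPolyBoundedProofSystem_iff_mem_NP_holds

/-- Under `¬S`, `TAUT` has a polynomially bounded proof system (the decider). -/
theorem hasPB_TAUT_of_not_pneNP (hS : ¬ PneNP) : HasPolyBoundedProofSystem TAUT := by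
  obtain ⟨V, ⟨hV, -⟩, hpb⟩ := decider_pOptimal_of_mem_P (TAUT_mem_P_of_not_pneNP hS)
  exact ⟨V, hV, hpb⟩

/-- (c) Piece A is IMPLIED BY `¬S` (vacuous in the `P = NP` world): it carries nothing toward `S`. -/
theorem pieceA_of_not_pneNP (hS : ¬ PneNP) : PieceA :=
  pieceA_iff.2 fun hno => absurd (hasPB_TAUT_of_not_pneNP hS) hno

/-- (c) Piece B is SUMMIT-OR-HARDER: `PieceB → PneNP` (the cheap probe misses this 3-step proof). -/
theorem pieceB_ge_S : PieceB → PneNP :=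
  split_piece_ge_S (fun hA hB => D1_assembly hA hB) pieceA_of_not_pneNP

/-- … and Piece B is strictly BELOW the crux only through the open `NP ≠ coNP` branch: `X → PieceB` trivially. -/
theorem pieceB_of_X (hX : NoPOptimalTaut) : PieceB := pieceB_iff.2 fun _ => hX

theorem pieceA_of_X (hX : NoPOptimalTaut) : PieceA := pieceA_iff.2 fun _ => hX

/-! ## §3 D3 — chain splits `X ⇐ M ∧ (M → X)` at consequences `M` of the crux -/

/-- D3a, `M := E ≠ NE` (Krajíček–Pudlák): `M` is a consequence (`X_imp_E_ne_NE`), `M` is summit-or-harder,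
and the bridge `E ≠ NE → X` (the open CONVERSE of KP89) is implied by `¬S`. -/
theorem D3a :
    (NoPOptimalTaut → E ≠ NE) ∧ (E ≠ NE → PneNP) ∧ (¬ PneNP → (E ≠ NE → NoPOptimalTaut)) :=
  ⟨X_imp_E_ne_NE, (chain_decided_by_not_S fun hS hM => hM (E_eq_NE_of_not_pneNP hS)).1,
    (chain_decided_by_not_S fun hS hM => hM (E_eq_NE_of_not_pneNP hS)).2⟩

/-- D3c, `M := CON ∨ SAT` (Pudlák 2017 figure: `CON → CON ∨ SAT ← SAT`, `CON ∨ SAT → RFN₁ → P ≠ NP`):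
the bridge `(X ∨ NoPOptimalSat) → X` is `NoPOptimalSat → X` ("no p-optimal system for `SAT` ⇒ none for
`TAUT`", open; Pudlák draws `CON` and `SAT` incomparable), `M` is summit-or-harder, the bridge is implied by `¬S`. -/
theorem D3c :
    (NoPOptimalTaut → NoPOptimalTaut ∨ NoPOptimalSat) ∧
      (((NoPOptimalTaut ∨ NoPOptimalSat) → NoPOptimalTaut) ↔ (NoPOptimalSat → NoPOptimalTaut)) ∧
      ((NoPOptimalTaut ∨ NoPOptimalSat) → PneNP) ∧
      (¬ PneNP → ((NoPOptimalTaut ∨ NoPOptimalSat) → NoPOptimalTaut)) := by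
  have hdec : ¬ PneNP → ¬ (NoPOptimalTaut ∨ NoPOptimalSat) := fun hS h =>
    h.elim (not_X_of_not_pneNP hS) (not_noPOptimalFor_of_mem_P (SAT_mem_P_of_not_pneNP hS))
  refine ⟨Or.inl, ⟨fun h hs => h (Or.inr hs), fun h hm => hm.elim id h⟩,
    (chain_decided_by_not_S hdec).1, (chain_decided_by_not_S hdec).2⟩

/-- D3d, `M := PneNP` itself: the split `{S, S → X}` — the first piece IS the summit (fails (c) by `id`);
the second is the famous open converse "P ≠ NP ⇒ no p-optimal proof system" (no relativizing proof:
Dose 2020, arXiv:1909.02839). -/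
theorem D3d : (NoPOptimalTaut → PneNP) ∧ (PneNP → (PneNP → NoPOptimalTaut) → NoPOptimalTaut) :=
  ⟨closes, fun hS h => h hS⟩

/-! ## §4 D4 — bridge splits `X ⇐ T ∧ (T → X)` from strengthenings `T` -/

/-- D4a, `T := NoOptimalTaut` (`CON^N`): the bridge is ONE LINE over the tree fact `PSimulates.simulates`
(p-simulation ⇒ simulation) — a "structured strengthening with no known converse" (RULE-N). -/
theorem D4a_bridge (hT : NoOptimalTaut) : NoPOptimalTaut := fun ⟨V, hV, hopt⟩ =>
  hT ⟨V, hV, fun W hW => PSimulates.simulates_holds (hopt W hW)⟩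

/-- `CON^N` is even further above the summit: it implies `co NE ≠ NE` (Krajíček 2019 Cor. 21.1.3, tree). -/
theorem D4a_T_imp_coNE_ne_NE (hT : NoOptimalTaut) : co NE ≠ NE := co_NE_ne_NE_of_no_optimal hT

/-- D4b, `T := DescriptiveThesis` (Gurevich's conjecture, the route's rank-0 crux): the bridge
`ThesisGivesNoPOptimalTaut` is the PROVED item stmt-PneNP-14715 (Chen–Flum 2010 Cor. 10), but
`T → PneNP` is LANDED (`descriptive_faginBridge_proof`, stmt-PneNP-9099) — clause (c) "no landed theorem
of shape `T → S`" fails by the letter, and in substance the redirect is circular (the route is `T ⇒ X ⇒ S`). -/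
theorem D4b : (DescriptiveThesis → NoPOptimalTaut) ∧ (DescriptiveThesis → PneNP) :=
  ⟨Summit.PneNP.PneNP.Theorems.descriptive_thesisGivesNoPOptimalTaut_proof,
    Summit.PneNP.PneNP.Theorems.descriptive_faginBridge_proof⟩

open scoped Literature.Computability.Complexity.Notation in
/-- D4c, `T :=` "UP has no `≤ₚ`-complete set" (Hartmanis–Hemachandra 1988; Pudlák 2017 Conjecture 14). -/
def NoCompleteUP : Prop :=
  ¬ ∃ A ∈ UP, ∀ B ∈ UP, B ≤ₚ A

/-- The Köbler–Messner–Torán bridge "p-optimal proof system for `TAUT` ⇒ `UP` has a complete set"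
(Inf. Comput. 184 (2003); Pudlák 2017 §6.3) — IN PRINT, not vendored; recorded as a `Prop` so that the
Wiles-shape split `X ⇐ NoCompleteUP ∧ KMT2003Bridge` is typed. [cite: KoblerMessnerToran2003, Cor. (UP)] -/
def KMT2003Bridge : Prop := NoCompleteUP → NoPOptimalTaut

/-- D4c assembly (modus ponens; the content is KMT's theorem). -/
theorem D4c_assembly (hT : NoCompleteUP) (hKMT : KMT2003Bridge) : NoPOptimalTaut := hKMT hT

/-! ## §5 D5 — instance splits at a fixed proof system `V₀` -/

/-- `Inst V₀`: "`V₀` is not p-optimal" (if it is a proof system for `TAUT` at all, some `W` escapes it). For a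
strong concrete `V₀` (e.g. `EF`, or the ZFC-based system) this is OPEN, is a consequence of the crux, and is
NOT refuted by `¬S` (under `P = NP` a system that is not polynomially bounded cannot be p-optimal, and `P = NP`
does not make `EF` polynomially bounded) — the honest `S`-free consequence of `X`. -/
def Inst (V₀ : List Bool → List Bool → Bool) : Prop :=
  IsProofSystemFor V₀ TAUT → ∃ W : List Bool → List Bool → Bool, IsProofSystemFor W TAUT ∧ ¬ PSimulates V₀ W

/-- `Univ V₀`: "if `TAUT` has a p-optimal proof system at all then `V₀` is one" (the bridge of the instance
split). -/
def Univ (V₀ : List Bool → List Bool → Bool) : Prop := Inst V₀ → NoPOptimalTaut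

/-- (b) assembly of the instance split (modus ponens). -/
theorem D5_assembly {V₀ : List Bool → List Bool → Bool} (hI : Inst V₀) (hU : Univ V₀) : NoPOptimalTaut := hU hI

/-- `Inst V₀` is a consequence of the crux. -/
theorem inst_of_X {V₀ : List Bool → List Bool → Bool} (hX : NoPOptimalTaut) : Inst V₀ := fun hV₀ => by
  by_contra h
  push Not at h
  exact hX ⟨V₀, hV₀, h⟩

/-- The bridge `Univ V₀` is `X ∨ ¬Inst V₀`: its `E`-part "`V₀` is p-optimal" is believed FALSE for every
concrete Cook–Reckhow `V₀` (that is what the crux says), so in the believed world `Univ V₀` is the crux again —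
costume; and no mechanism "p-optimality exists ⇒ THIS system has it" is in print (only with one bit of advice,
Cook–Krajíček 2007, or relative to a theory `T`, Krajíček 2019 §21.6). -/
theorem univ_iff (V₀ : List Bool → List Bool → Bool) : Univ V₀ ↔ (NoPOptimalTaut ∨ ¬ Inst V₀) :=
  bridge_iff (Inst V₀)

/-- `Univ V₀` unfolded: "if some system is p-optimal then `V₀` p-simulates everything". -/
theorem univ_iff' {V₀ : List Bool → List Bool → Bool} (hV₀ : IsProofSystemFor V₀ TAUT) :
    Univ V₀ ↔ (¬ NoPOptimalTaut → ∀ W : List Bool → List Bool → Bool,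
      IsProofSystemFor W TAUT → PSimulates V₀ W) := by
  constructor
  · intro hU hX W hW
    by_contra hnot
    exact hX (hU fun _ => ⟨W, hW, hnot⟩)
  · intro h hI
    by_contra hX
    obtain ⟨W, hW, hnot⟩ := hI hV₀
    exact hnot (h hX W hW)

/-- Degenerate instances: whenever `Inst V₀` is a THEOREM (e.g. the truth-table system, or any `V₀` that is
not even a proof system for `TAUT`), the bridge `Univ V₀` is literally equivalent to the crux. -/
theorem univ_iff_X_of_inst {V₀ : List Bool → List Bool → Bool} (hI : Inst V₀) : Univ V₀ ↔ NoPOptimalTaut :=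
  ⟨fun hU => hU hI, fun hX _ => hX⟩

/-- The instance split with `V₀` left universally quantified IS the crux (costume certificate). -/
theorem X_iff_forall_inst :
    NoPOptimalTaut ↔ ∀ V₀ : List Bool → List Bool → Bool, Inst V₀ :=
  ⟨fun hX _ => inst_of_X hX, fun h ⟨V, hV, hopt⟩ => by
    obtain ⟨W, hW, hnot⟩ := h V hV
    exact hnot (hopt W hW)⟩

/-! ## §6 D2 / D8 — Krajíček's trichotomy seam and the generic case split -/

/-- Krajíček 2004 (*Diagonalization in proof complexity*; Krajíček 2019 Thm. 21.4.3): at least one of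
(i) `E` has a function of circuit complexity `2^{Ω(n)}`, (ii) `NP ≠ coNP`, (iii) `X` holds. As a split:
`X ⇐ ((i) → X) ∧ ((ii) → X) ∧ trichotomy` — the seam is this case analysis; the piece `(ii) → X` is `PieceA`
(`pieceA_iff`, with (ii) rendered `¬HasPolyBoundedProofSystem TAUT`), implied by `¬S`; the piece `(i) → X`
is summit-or-harder as soon as `¬S → (i)` (Kannan 1982 + Karp–Lipton: `P = NP ⇒ E ⊄ SIZE(2^{δn})`, in print). -/
theorem krajicek_seam {HardE NPneCoNP : Prop} (htri : HardE ∨ NPneCoNP ∨ NoPOptimalTaut)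
    (h₁ : HardE → NoPOptimalTaut) (h₂ : NPneCoNP → NoPOptimalTaut) : NoPOptimalTaut :=
  htri.elim h₁ fun h => h.elim h₂ id

/-- The `(i)`-piece is summit-or-harder given the (printed, not vendored) collapse consequence `¬S → (i)`. -/
theorem krajicek_piece_i_ge_S {HardE : Prop} (hKannanKL : ¬ PneNP → HardE) :
    (HardE → NoPOptimalTaut) → PneNP :=
  split_piece_ge_S (P₁ := HardE) (fun hH h => h hH) hKannanKL

/-! ## §7 D6 — the language ladder -/

/-- `X_TQBF := NoPOptimalFor TQBF` ("true quantified Boolean formulas have no p-optimal proof system",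
Sadowski FCT 1997): a consequence of the crux by downward closure of p-optimality under `≤ₚ`
(Köbler–Messner–Torán 2003; Chen–Flum 2010b §3 (3)) since `TAUT ≤ₚ TQBF`; it implies only `P ≠ PSPACE`
(`not_noPOptimalFor_of_mem_P`). The upward bridge `X_TQBF → X` ("p-optimality climbs from `coNP`- to
`PSPACE`-complete sets") has no mechanism in print; at the top of the ladder `EXP`-hard sets provably have
no p-optimal proof system (Messner; Chen–Flum 2010b §3 (4)). -/
def X_TQBF : Prop := NoPOptimalFor Literature.Barriers.QuantumAdvantage.TQBF

/-- The ladder piece `NoPOptimalFor L` is refuted by `L ∈ P`; so every rung implies `L ∉ P` only. -/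
theorem ladder_piece_imp_not_mem_P {L : Language Bool} (h : NoPOptimalFor L) : L ∉ Classes.P :=
  fun hLP => not_noPOptimalFor_of_mem_P hLP h

end Summit.PneNP.PneNP.Cruxes.NoPOptimalTaut.DecompositionAudit
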